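/-
Origin: expansion seat `planner-pub-hodgecm-pohl-g8-0`, handover #1 2026-08-18T07:23:41Z (`HOME/pub-hodgecm-pohl-g8/lean/Pohl8/DegreeZeroIff.lean`, md5 c5a72d31, 216 lines);
landed by the gen-7 packager in gate run 26 as `HodgeCM/Proofs/Pohlmann/DegreeZeroIff.lean` (verbatim).
-/
/-
Copyright: pub-hodgecm formalisation cell (harness21, 2026). New file (not vendored).
Origin: HOME/pub-hodgecm-pohl-g8/lean/Pohl8/DegreeZeroIff.lean — session planner-pub-hodgecm-pohl-g8-0 (unit pub-hodgecm-pohl-g8),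
EXPANSION part (b) `PohlmannSpan`, generation 8.  Intended final place: `HodgeCM/Proofs/Pohlmann/DegreeZeroIff.lean`
(module `HodgeCM.Proofs.Pohlmann.DegreeZeroIff`).  ADDITIVE leaf: imports the certified `HodgeCM.Proofs.Pohlmann.DegreeZeroGeneric`
(pohl-g6, gate run 24) only; replaces nothing; nothing imports it.
-/
import Summits.HodgeConjecture.HodgeCM.Proofs.Pohlmann.DegreeZeroGeneric

/-!
# The degree-`0` input of Gao–Ullmo Thm 3.1 (all `p ≥ 0`) is NECESSARY AND SUFFICIENT

Gao–Ullmo, *J. Inst. Math. Jussieu* **25** (2025) 215–249 (= arXiv:2411.12249), Thm 3.1 "(Pohlmann)"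
[corpus:paper:arxiv-2411.12249 p0009 L32–L39]: "For each `p ≥ 0`, the vector space `B^p(A) ⊗ ℂ` has a basis consisting of `[P]`
for those ordered sets `P ∈ 𝒫(S)` with `|P| = 2p` such that (3.2) … In particular `dim_ℚ B^p(A)` is the number of ordered
`P ∈ 𝒫(S)` with `|P| = 2p` satisfying (3.2)."  At `p = 0` the only such `P` is `∅`, `[∅] = 1 ∈ ⋀⁰ ℂ^S = H⁰(A, ℂ)`
[p0009 L16: "We have an isomorphism `H^r(A, ℂ) = ⋀^r ℂ^S`"], and `B⁰(A) = H^{0,0} ∩ H⁰(A, ℚ) = H⁰(A, ℚ)` [p0009 L8, L11: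
`B(A) := ⊕_{p=0}^{g} B^p(A)`]; so the `p = 0` clause of Thm 3.1 SAYS `dim_ℚ H⁰(A, ℚ) = 1`.

In the package (`HodgeCM.Universe`, product form `A′ = ∏_{j ≤ n} A_{(F,Θ_j)}`, `F` a Galois CM field) the lineage proved
* `Universe.PohlmannTheorem31` (Thm 3.1 for `p ≥ 1`) OUTRIGHT from `ModelAxioms` + N1–N4 (pohl-g3, `WeightLines.lean`
  `pohlmannTheorem31_of_facts`), and
* `Universe.PohlmannTheorem31All` (Thm 3.1 for every `p ≥ 0`) from `ModelAxioms` + N1–N4 + ONE degree-`0` input, in any of the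
  forms `CMProdConnected` (pohl-g5), F6 `Fact_weightDual` (pohl-g5), `Fact_H0_rank` (M42, pohl-g6), the generic monomial facts
  (pohl-g6), F-H0 `Fact_unitH0` (qw8b-g3, run-25 queue); and pohl-g7's transform `U ↦ U♭` (run-25 queue) shows that SOME
  degree-`0` input is needed (`KillH0.not_pohlmannTheorem31All`: Thm 3.1 at `p = 0` fails when `H⁰ = 0`).

This file closes the analysis with the EXACT strength of the all-`p` statement over `ModelAxioms` + N1–N4:

  `pohlmannTheorem31All_iff : PohlmannTheorem31All ↔ CMProdConnectedGalois`

where `CMProdConnectedGalois U := ∀ F Galois CM, ∀ n Θ, dim_ℚ H⁰(∏_{j ≤ n} A_{(F,Θ_j)}, ℚ) = 1` is `CMProdConnected` (pohl-g5,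
`DegreeZero.lean`) RESTRICTED to Galois `F` — the only fields `PohlmannTheorem31All` speaks about.

* (→) `cmProdConnectedGalois_of_pohlmannTheorem31All` needs ONLY N4 `Fact_hodge_F0` (`B⁰ = H⁰`, pohl-g5
  `hodgeClassesOf_zero_eq_top`) and the count `#{S : IsHodgeWeight Θ 0 S} = 1` (pohl-g5 `card_isHodgeWeight_zero`): the second
  sentence of Thm 3.1 at `p = 0` reads `dim_ℚ H⁰(A′, ℚ) = 1`.  So the degree-`0` input is NECESSARY — not merely an artefact of
  the proofs — and every universe in which Thm 3.1 holds for all `p` has `H⁰(A′) ≠ 0` for all Galois CM products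
  (`nontrivial_coh_zero_of_pohlmannTheorem31All`); this is the abstract form of pohl-g7's `KillH0.not_pohlmannTheorem31All`.
* (←) `pohlmannTheorem31All_of_connectedGalois`: `p ≥ 1` is pohl-g3's theorem verbatim (no degree-`0` input); `p = 0` is done
  DIRECTLY (`exists_basis_hodgeClassesOf_zero_of_finrank`, `finrank_hodgeClassesOf_zero_of_finrank`): `B⁰ ⊗ ℂ = H⁰ ⊗ ℂ` is a
  line (N4 + the hypothesis), the index type `{S // IsHodgeWeight Θ 0 S}` is the singleton `{(∅)_j}` (pohl-g5
  `isHodgeWeight_zero_iff`), any basis vector lies in `V_{(∅)_j} = H⁰ ⊗ ℂ` (N3, pohl-g5 `weightSpace_empty_zero_eq_top`).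
  Only the value of `dim H⁰` at the SAME `(F, Θ)` is used, which is why the Galois-restricted form suffices (pohl-g5's
  `pohlmannTheorem31All_of_connected` asks `CMProdConnected` for all CM fields).
* Corollaries: `pohlmannTheorem31All_iff_nontrivial` (over the GENERIC monomial list of pohl-g6 — `ModelAxioms`, N1–N4, F7
  `Fact_gysin`, `Fact_trTopCM`, under which `dim H⁰(A′) ≤ 1` — Thm 3.1 for all `p` ⟺ `H⁰(A′) ≠ 0` for Galois `F`);
  the known sufficient conditions factor through `CMProdConnectedGalois` (`cmProdConnectedGalois_of_connected`,
  `_of_H0_rank`, `_of_weightDual`).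

Everything here is KERNEL-PROVED over the certified tree (`ModelAxioms`, N1–N4 are the binders already adjudicated for the
Pohlmann lane; no new `Fact_`); nothing is cited as a hypothesis, no statement is named after PerL / [QW8] / the 2001 programme.
`CMProdConnectedGalois` is NOT posited: it is named only to state the equivalence.
-/

noncomputable section

open scoped TensorProduct

namespace HodgeCM

namespace Universe

open Literature.AlgebraicGeometry.Motives (CMType)

variable {U : Universe}

/-- **Connectedness of the Galois CM products**: `dim_ℚ H⁰(∏_{j ≤ n} A_{(F,Θ_j)}, ℚ) = 1` for every GALOIS CM field `F` and all
CM types `Θ_0, …, Θ_n` — pohl-g5's `CMProdConnected` restricted to the fields about which `PohlmannTheorem31All` speaks.  It is the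
`p = 0` clause of Gao–Ullmo Thm 3.1 [corpus:paper:arxiv-2411.12249 p0009 L32–L39 with L8, L16].  NOT posited (named only to state
`pohlmannTheorem31All_iff`); implied by `CMProdConnected`, by M42 `Fact_H0_rank`, by F6 (with `ModelAxioms` + N1 + N3). -/
def CMProdConnectedGalois (U : Universe) : Prop :=
  ∀ (F : CMField), IsGalois ℚ F → ∀ (n : ℕ) (Θ : Fin (n + 1) → CMType F),
    Module.finrank ℚ (U.Coh (U.cmProd F Θ) 0) = 1

/-- (Ported verbatim from the HodgeCMPerL package; no docstring in the source.) -/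
theorem cmProdConnectedGalois_of_connected (h0 : U.CMProdConnected) : U.CMProdConnectedGalois :=
  fun F _ n Θ => h0 F n Θ

/-- (Ported verbatim from the HodgeCMPerL package; no docstring in the source.) -/
theorem cmProdConnectedGalois_of_H0_rank (h0 : U.Fact_H0_rank) : U.CMProdConnectedGalois :=
  cmProdConnectedGalois_of_connected (cmProdConnected_of_H0_rank h0)

/-- (Ported verbatim from the HodgeCMPerL package; no docstring in the source.) -/
theorem cmProdConnectedGalois_of_weightDual (M : U.ModelAxioms) (hN1 : U.Fact_cupExterior) (hN3 : U.Fact_pull_H0)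
    (h6 : U.Fact_weightDual) : U.CMProdConnectedGalois :=
  cmProdConnectedGalois_of_connected (cmProdConnected_of_facts M hN1 hN3 h6)

/-! ## Necessity: Thm 3.1 at `p = 0` says `dim_ℚ H⁰(A′) = 1` -/

section Necessity

variable {F : CMField} {n : ℕ}

/-- **The second sentence of Thm 3.1 at `p = 0` is `dim_ℚ H⁰(A′, ℚ) = 1`** (N4: `B⁰ = H⁰`; the index set at `p = 0` is `{(∅)_j}`). -/
theorem finrank_coh_zero_eq_one_iff (hN4 : U.Fact_hodge_F0) (Θ : Fin (n + 1) → CMType F) :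
    Module.finrank ℚ (U.hodgeClassesOf (U.cmProd F Θ) 0) =
        Nat.card {S : Fin (n + 1) → Finset ((F : Type) →+* ℂ) // IsHodgeWeight Θ 0 S} ↔
      Module.finrank ℚ (U.Coh (U.cmProd F Θ) 0) = 1 := by
  rw [card_isHodgeWeight_zero, hodgeClassesOf_zero_eq_top hN4, finrank_top]

/-- **Necessity of the degree-`0` input**: if Gao–Ullmo Thm 3.1 holds for all `p ≥ 0`, then `dim_ℚ H⁰(A′, ℚ) = 1` for every
Galois CM product `A′` — using only N4 `Fact_hodge_F0`. -/
theorem finrank_coh_zero_of_pohlmannTheorem31All (hN4 : U.Fact_hodge_F0) (h : U.PohlmannTheorem31All)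
    (F : CMField) [hG : IsGalois ℚ F] (Θ : Fin (n + 1) → CMType F) :
    Module.finrank ℚ (U.Coh (U.cmProd F Θ) 0) = 1 :=
  (finrank_coh_zero_eq_one_iff hN4 Θ).1 (h F hG n Θ 0).2

/-- (Ported verbatim from the HodgeCMPerL package; no docstring in the source.) -/
theorem cmProdConnectedGalois_of_pohlmannTheorem31All (hN4 : U.Fact_hodge_F0) (h : U.PohlmannTheorem31All) :
    U.CMProdConnectedGalois := by
  intro F hG _ Θ
  haveI := hG
  exact finrank_coh_zero_of_pohlmannTheorem31All hN4 h F Θ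

/-- In particular `H⁰(A′) ≠ 0` for every Galois CM product wherever Thm 3.1 holds for all `p` (the abstract form of pohl-g7's
`KillH0.not_pohlmannTheorem31All`: no universe with `H⁰ = 0` satisfies `PohlmannTheorem31All`). -/
theorem nontrivial_coh_zero_of_pohlmannTheorem31All (hN4 : U.Fact_hodge_F0) (h : U.PohlmannTheorem31All)
    (F : CMField) [IsGalois ℚ F] (Θ : Fin (n + 1) → CMType F) : Nontrivial (U.Coh (U.cmProd F Θ) 0) :=
  Module.nontrivial_of_finrank_eq_succ (finrank_coh_zero_of_pohlmannTheorem31All hN4 h F Θ)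

end Necessity

/-! ## Sufficiency: the `p = 0` clause from `dim_ℚ H⁰(A′) = 1` at the same `(F, Θ)` -/

section Sufficiency

variable {F : CMField} {n : ℕ} {Θ : Fin (n + 1) → CMType F}

/-- Thm 3.1, second sentence, at `p = 0`, from `dim_ℚ H⁰(A′) = 1` (N4). -/
theorem finrank_hodgeClassesOf_zero_of_finrank (hN4 : U.Fact_hodge_F0)
    (h0 : Module.finrank ℚ (U.Coh (U.cmProd F Θ) 0) = 1) :
    Module.finrank ℚ (U.hodgeClassesOf (U.cmProd F Θ) 0) =
      Nat.card {S : Fin (n + 1) → Finset ((F : Type) →+* ℂ) // IsHodgeWeight Θ 0 S} :=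
  (finrank_coh_zero_eq_one_iff hN4 Θ).2 h0

/-- `dim_ℂ (B⁰(A′) ⊗ ℂ) = 1` from `dim_ℚ H⁰(A′) = 1` (N4). -/
theorem finrank_baseChange_hodgeClassesOf_zero (hN4 : U.Fact_hodge_F0)
    (h0 : Module.finrank ℚ (U.Coh (U.cmProd F Θ) 0) = 1) :
    Module.finrank ℂ ↥((U.hodgeClassesOf (U.cmProd F Θ) 0).baseChange ℂ) = 1 := by
  rw [← (Submodule.toBaseChange.toLinearEquiv ℂ (U.hodgeClassesOf (U.cmProd F Θ) 0)).finrank_eq,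
    Module.finrank_baseChange, hodgeClassesOf_zero_eq_top hN4, finrank_top]
  exact h0

/-- The index set of Thm 3.1 at `p = 0` is the singleton `{(∅)_j}` (pohl-g5 `isHodgeWeight_zero_iff`). -/
theorem nonempty_unique_isHodgeWeight_zero (Θ : Fin (n + 1) → CMType F) :
    Nonempty (Unique {S : Fin (n + 1) → Finset ((F : Type) →+* ℂ) // IsHodgeWeight Θ 0 S}) :=
  ⟨{ default := ⟨fun _ => ∅, (isHodgeWeight_zero_iff _).2 rfl⟩
     uniq := fun S => Subtype.ext ((isHodgeWeight_zero_iff S.1).1 S.2) }⟩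

/-- **Thm 3.1, first sentence, at `p = 0`, from `dim_ℚ H⁰(A′) = 1`**: `B⁰(A′) ⊗ ℂ` has a basis indexed by the (unique) Hodge
weight `(∅)_j` whose member is a weight vector of weight `(∅)_j` — i.e. any nonzero element of the line `H⁰(A′, ℂ)`
(N3: `V_{(∅)_j} = H⁰ ⊗ ℂ` in degree `0`; N4: `B⁰ = H⁰`). -/
theorem exists_basis_hodgeClassesOf_zero_of_finrank (hN3 : U.Fact_pull_H0) (hN4 : U.Fact_hodge_F0)
    (h0 : Module.finrank ℚ (U.Coh (U.cmProd F Θ) 0) = 1) :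
    ∃ b : Module.Basis {S : Fin (n + 1) → Finset ((F : Type) →+* ℂ) // IsHodgeWeight Θ 0 S} ℂ
        ↥((U.hodgeClassesOf (U.cmProd F Θ) 0).baseChange ℂ),
      ∀ S, ((b S : ↥((U.hodgeClassesOf (U.cmProd F Θ) 0).baseChange ℂ)) : U.CohC (U.cmProd F Θ) (2 * 0)) ∈
        U.weightSpace F Θ S.1 (2 * 0) := by
  obtain ⟨hU⟩ := nonempty_unique_isHodgeWeight_zero Θ
  refine ⟨Module.basisUnique _ (finrank_baseChange_hodgeClassesOf_zero hN4 h0), fun S => ?_⟩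
  have hS : S.1 = fun _ => ∅ := (isHodgeWeight_zero_iff S.1).1 S.2
  rw [hS]
  show _ ∈ U.weightSpace F Θ (fun _ => ∅) 0
  rw [weightSpace_empty_zero_eq_top hN3]
  exact Submodule.mem_top

end Sufficiency

/-- **Sufficiency**: Thm 3.1 for every `p ≥ 0` from `ModelAxioms` + N1–N4 + connectedness of the GALOIS CM products
(`p ≥ 1`: pohl-g3 `exists_basis_hodgeClassesOf` / `finrank_hodgeClassesOf`, no degree-`0` input; `p = 0`: the two lemmas above,
at the same `(F, Θ)`).  Refines pohl-g5's `pohlmannTheorem31All_of_connected` (which asks `dim H⁰(A′) = 1` for ALL CM fields). -/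
theorem pohlmannTheorem31All_of_connectedGalois (M : U.ModelAxioms) (hN1 : U.Fact_cupExterior) (hN2 : U.Fact_cup_hodge)
    (hN3 : U.Fact_pull_H0) (hN4 : U.Fact_hodge_F0) (h0 : U.CMProdConnectedGalois) : U.PohlmannTheorem31All := by
  intro F hG n Θ p
  haveI := hG
  cases p with
  | zero =>
    exact ⟨exists_basis_hodgeClassesOf_zero_of_finrank hN3 hN4 (h0 F hG n Θ),
      finrank_hodgeClassesOf_zero_of_finrank hN4 (h0 F hG n Θ)⟩
  | succ q =>
    exact ⟨exists_basis_hodgeClassesOf (F := F) (n := n) (Θ := Θ) M hN1 hN2 hN3 hN4 (Nat.succ_pos q),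
      finrank_hodgeClassesOf (F := F) (n := n) (Θ := Θ) M hN1 hN2 hN3 hN4 (Nat.succ_pos q)⟩

/-- **The exact strength of Gao–Ullmo Thm 3.1 for all `p ≥ 0` over `ModelAxioms` + N1–N4**: it is EQUIVALENT to connectedness
(`dim_ℚ H⁰ = 1`) of the CM products `∏_{j ≤ n} A_{(F,Θ_j)}` over Galois CM fields `F`.  [(→) uses only N4; (←) uses
`ModelAxioms` + N1–N4.]  Hence the degree-`0` input isolated by pohl-g4/g5/g6 is NECESSARY as well as sufficient, and pohl-g7's
independence theorem (`Toy.degreeZero_independent`: a universe with the trace-free generic facts and `H⁰ = 0`) is, read through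
this equivalence, the statement that `CMProdConnectedGalois` is independent of that list. -/
theorem pohlmannTheorem31All_iff (M : U.ModelAxioms) (hN1 : U.Fact_cupExterior) (hN2 : U.Fact_cup_hodge)
    (hN3 : U.Fact_pull_H0) (hN4 : U.Fact_hodge_F0) : U.PohlmannTheorem31All ↔ U.CMProdConnectedGalois :=
  ⟨cmProdConnectedGalois_of_pohlmannTheorem31All hN4, pohlmannTheorem31All_of_connectedGalois M hN1 hN2 hN3 hN4⟩

/-- Over `ModelAxioms` + N1–N4 the all-`p` theorem is `PohlmannTheorem31 ∧ CMProdConnectedGalois`, the first conjunct being a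
THEOREM (pohl-g3): the `p = 0` clause carries exactly the connectedness and nothing else. -/
theorem pohlmannTheorem31All_iff_and (M : U.ModelAxioms) (hN1 : U.Fact_cupExterior) (hN2 : U.Fact_cup_hodge)
    (hN3 : U.Fact_pull_H0) (hN4 : U.Fact_hodge_F0) :
    U.PohlmannTheorem31All ↔ U.PohlmannTheorem31 ∧ U.CMProdConnectedGalois :=
  ⟨fun h => ⟨pohlmannTheorem31_of_all h, cmProdConnectedGalois_of_pohlmannTheorem31All hN4 h⟩,
    fun h => pohlmannTheorem31All_of_connectedGalois M hN1 hN2 hN3 hN4 h.2⟩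

/-- **Over pohl-g6's GENERIC monomial list** (`ModelAxioms`, N1–N4, F7 `Fact_gysin`, `Fact_trTopCM`), under which
`dim_ℚ H⁰(A′) ≤ 1` is a theorem (`finrank_coh_zero_cmProd_le_one_generic`): Thm 3.1 for all `p ≥ 0` ⟺ `H⁰(A′) ≠ 0` for every
Galois CM product. -/
theorem pohlmannTheorem31All_iff_nontrivial (M : U.ModelAxioms) (hN1 : U.Fact_cupExterior) (hN2 : U.Fact_cup_hodge)
    (hN3 : U.Fact_pull_H0) (hN4 : U.Fact_hodge_F0) (h7 : U.Fact_gysin) (ht : U.Fact_trTopCM) :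
    U.PohlmannTheorem31All ↔
      ∀ (F : CMField), IsGalois ℚ F → ∀ (n : ℕ) (Θ : Fin (n + 1) → CMType F), Nontrivial (U.Coh (U.cmProd F Θ) 0) := by
  refine ⟨fun h F hG n Θ => ?_, fun h => ?_⟩
  · haveI := hG
    exact nontrivial_coh_zero_of_pohlmannTheorem31All hN4 h F Θ
  refine pohlmannTheorem31All_of_connectedGalois M hN1 hN2 hN3 hN4 fun F hG n Θ => ?_
  haveI := h F hG n Θ
  exact le_antisymm (finrank_coh_zero_cmProd_le_one_generic M hN1 hN3 h7 ht) Module.finrank_pos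

end Universe

end HodgeCM

end
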